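import Summits.MatrixMultiplication.OmegaCensus.STPPRankMonotone
import Literature.Computability.AlgebraicComplexity.MatMulM22RankLowerBoundProofs
import Literature.Computability.AlgebraicComplexity.SmallFormatRankProofs

/-!
# ω-census (abelian STPP census, seat stpp-2), filter N7 part 6: the engine's `paper` rank table is a kernel table

HONEST FRAMING (pub-omega census; verbatim): lottery ticket; floor = certified bounds/negative ranges.
Census BOOKKEEPING (pub-omega stpp-2 gen 20, 2026-08-27).  Nothing here is progress on `ω`.

The census engine of record (census.py v0.10 + lister.c, filter N7) has two single-block rank tables for a FAT block
`⟨a,b,c⟩` (`patterns.N7_KERNEL_RLB` / `N7_PAPER_RLB`, lister.c `N7K` / `N7P`, selected by the kit env `JOB_N7 = kernel | paper`):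
`kernel = {222: 7, 223: 10, 233: 14, 333: 14}` (in the kernel as part 4's `STPPRank.rlbKernel_le_tensorRank`) and
`paper = {222: 7, 223: 11, 233: 14, 333: 19, 224: 14}`, so far booked as 'uses named print facts ×1'.  The three print
facts are THEOREMS OF THE TREE over every field: `alekseyev1985_tensorRank_matMulTensor_322_232_223'` (`R(⟨2,2,3⟩) = 11`)
and `alekseevSmirnov2013_tensorRank_matMulTensor_224'` (`R(⟨2,2,4⟩) = 14`) in `MatMulM22RankLowerBoundProofs.lean`, and
`blaser2003_cor9_holds` (`19 ≤ R(⟨3,3,3⟩)`) in `SmallFormatRankProofs.lean`.  Hence, mirroring part 4 for the second table: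

* `STPPRank.rlbPaper a b c` — the engine's `paper` table as a function of the (unsorted) format (`patterns.rank_single_lb`,
  grade `paper`: best entry of a dominated sub-format; the flattening alternative is covered by the `gain` theorems of part 2);
* `STPPRank.rlbPaper_le_tensorRank` — **`rlbPaper a b c ≤ R(⟨a,b,c⟩)` over `ℂ`, a kernel theorem for every format**
  (the three tree theorems + Bläser 2013 Lemma 5.5 for orientations + `tensorRank_matMulTensor_mono`);
  `STPPRank.rlbPaper_values` (the five engine rows and monotone consequences, by `decide`);
  `STPPRank.rlbKernel_le_rlbPaper` (the `paper` table dominates the `kernel` table entrywise);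
* `STPPRank.rlbPaper_add_sum_gain_le_card_of_isSTPP` — filter N7 in `paper` mode with one distinguished block of any format:
  `rlbPaper(|A_{j₀}|,|B_{j₀}|,|C_{j₀}|) + ∑_{i ≠ j₀} gain(dᵢ;|Aᵢ|,|Bᵢ|,|Cᵢ|) ≤ |H|` — so a census word produced with
  `JOB_N7=paper` rests on kernel theorems only; and its one-fat-block frontier form
  `STPPRank.rlbPaper_add_sum_card_mul_le_of_isSTPP_of_thin`.
The census-shaped corollaries with explicit numbers (`3m+2`, `19`) and the six ℤ₅₆ leaves decided by them are the sibling
file `STPPThinFamiliesExactRanks.lean` (part 5); this file is independent of it.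
-/

noncomputable section

open scoped BigOperators

namespace Summit.MatrixMultiplication.OmegaCensus.STPPRank

open Literature.Computability.AlgebraicComplexity Module Finset

/-! ## The `paper`-grade single-block table of filter N7 -/

section Table

/-- The engine's `paper`-grade lower-bound table for `R(⟨a,b,c⟩)` as a function of the (unsorted) format: with
`s₁ ≤ s₂ ≤ s₃` the sorted format, `19` if `3 ≤ s₁`; else, when `2 ≤ s₁`: `14` if `3 ≤ s₂` (dominates `(2,3,3)`) or
`4 ≤ s₃` (dominates `(2,2,4)`), else `11` if `3 ≤ s₃` (dominates `(2,2,3)`), else `7` (`(2,2,2)`); and `0` for a thin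
block (`patterns.N7_PAPER_RLB` + `rank_single_lb`, census.py v0.10 / lister.c `N7P`). [folklore] -/
def rlbPaper (a b c : ℕ) : ℕ :=
  if 3 ≤ min a (min b c) then 19
  else if 2 ≤ min a (min b c) ∧ (3 ≤ max (min a b) (min (max a b) c) ∨ 4 ≤ max a (max b c)) then 14
  else if 2 ≤ min a (min b c) ∧ 3 ≤ max a (max b c) then 11
  else if 2 ≤ min a (min b c) then 7 else 0

/-- **The `paper`-grade table is a tree theorem for every format**: `rlbPaper a b c ≤ R(⟨a,b,c⟩)` over `ℂ`
(Alekseyev 1985 / Alekseev–Smirnov 2013 / Bläser 2003 as discharged in the tree, Bläser 2013 Lemma 5.5 for the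
orientations, sub-format monotonicity). [cite: Blaser2013, Lemma 5.4] -/
theorem rlbPaper_le_tensorRank (a b c : ℕ) : rlbPaper a b c ≤ tensorRank (matMulTensor ℂ a b c) := by
  -- the three print facts of the table, from the tree, in the orientations needed
  have h19 : 19 ≤ tensorRank (matMulTensor ℂ 3 3 3) := blaser2003_cor9_holds ℂ
  have h322 : 11 ≤ tensorRank (matMulTensor ℂ 3 2 2) :=
    (alekseyev1985_tensorRank_matMulTensor_322_232_223' ℂ).1.symm.le
  have h232 : 11 ≤ tensorRank (matMulTensor ℂ 2 3 2) :=
    (alekseyev1985_tensorRank_matMulTensor_322_232_223' ℂ).2.1.symm.le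
  have h223 : 11 ≤ tensorRank (matMulTensor ℂ 2 2 3) :=
    (alekseyev1985_tensorRank_matMulTensor_322_232_223' ℂ).2.2.symm.le
  have h224 : 14 ≤ tensorRank (matMulTensor ℂ 2 2 4) := (alekseevSmirnov2013_tensorRank_matMulTensor_224' ℂ).symm.le
  obtain ⟨e1, -, -, -, e5⟩ := Blaser2013_lemma55 (K := ℂ) 2 2 4
  have h422 : 14 ≤ tensorRank (matMulTensor ℂ 4 2 2) := e1 ▸ h224
  have h242 : 14 ≤ tensorRank (matMulTensor ℂ 2 4 2) := e5 ▸ h224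
  unfold rlbPaper
  split_ifs with c19 c14 c11 c7
  · exact h19.trans (tensorRank_matMulTensor_mono ℂ (le_trans c19 (min_le_left _ _))
      (le_trans c19 ((min_le_right _ _).trans (min_le_left _ _)))
      (le_trans c19 ((min_le_right _ _).trans (min_le_right _ _))))
  · obtain ⟨hmin, hor⟩ := c14
    have ha : 2 ≤ a := le_trans hmin (min_le_left _ _)
    have hb : 2 ≤ b := le_trans hmin ((min_le_right _ _).trans (min_le_left _ _))
    have hc : 2 ≤ c := le_trans hmin ((min_le_right _ _).trans (min_le_right _ _))
    rcases hor with hmid | hmax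
    · -- `3 ≤ max (min a b) (min (max a b) c)`: two of `a, b, c` are `≥ 3` — use the kernel entry `⟨2,3,3⟩ ↦ 14`
      refine fourteen_le_tensorRank_matMulTensor_of_le ha hb hc ?_
      rcases le_max_iff.mp hmid with h | h
      · exact Or.inl ⟨le_trans h (min_le_left _ _), le_trans h (min_le_right _ _)⟩
      · have hc3 : 3 ≤ c := le_trans h (min_le_right _ _)
        have hab : 3 ≤ max a b := le_trans h (min_le_left _ _)
        rcases le_max_iff.mp hab with h' | h'
        · exact Or.inr (Or.inl ⟨h', hc3⟩)
        · exact Or.inr (Or.inr ⟨h', hc3⟩)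
    · -- `4 ≤ max a (max b c)`: one of `a, b, c` is `≥ 4` — Alekseev–Smirnov
      rcases le_max_iff.mp hmax with h | h
      · exact h422.trans (tensorRank_matMulTensor_mono ℂ h hb hc)
      · rcases le_max_iff.mp h with h' | h'
        · exact h242.trans (tensorRank_matMulTensor_mono ℂ ha h' hc)
        · exact h224.trans (tensorRank_matMulTensor_mono ℂ ha hb h')
  · obtain ⟨hmin, hmax⟩ := c11
    have ha : 2 ≤ a := le_trans hmin (min_le_left _ _)
    have hb : 2 ≤ b := le_trans hmin ((min_le_right _ _).trans (min_le_left _ _))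
    have hc : 2 ≤ c := le_trans hmin ((min_le_right _ _).trans (min_le_right _ _))
    -- one of `a, b, c` is `≥ 3` — Alekseyev
    rcases le_max_iff.mp hmax with h | h
    · exact h322.trans (tensorRank_matMulTensor_mono ℂ h hb hc)
    · rcases le_max_iff.mp h with h' | h'
      · exact h232.trans (tensorRank_matMulTensor_mono ℂ ha h' hc)
      · exact h223.trans (tensorRank_matMulTensor_mono ℂ ha hb h')
  · exact seven_le_tensorRank_matMulTensor_of_two_le (le_trans c7 (min_le_left _ _))
      (le_trans c7 ((min_le_right _ _).trans (min_le_left _ _)))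
      (le_trans c7 ((min_le_right _ _).trans (min_le_right _ _)))
  · exact Nat.zero_le _

/-- Sanity values of the table: the engine's five `N7_PAPER_RLB` rows (`222: 7, 223: 11, 233: 14, 333: 19, 224: 14`) in
several orientations, monotone consequences (`234 ↦ 14`, `334 ↦ 19`, `225 ↦ 14`), and a thin block (`0`). [folklore] -/
theorem rlbPaper_values :
    rlbPaper 2 2 2 = 7 ∧ rlbPaper 2 2 3 = 11 ∧ rlbPaper 2 3 2 = 11 ∧ rlbPaper 3 2 2 = 11 ∧ rlbPaper 2 3 3 = 14 ∧
      rlbPaper 3 3 3 = 19 ∧ rlbPaper 2 2 4 = 14 ∧ rlbPaper 4 2 2 = 14 ∧ rlbPaper 2 4 2 = 14 ∧ rlbPaper 2 3 4 = 14 ∧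
      rlbPaper 3 3 4 = 19 ∧ rlbPaper 2 2 5 = 14 ∧ rlbPaper 1 4 4 = 0 := by
  decide

/-- The `paper` table dominates the `kernel` table entrywise (every `kernel`-mode pruning is a `paper`-mode pruning).
[folklore] -/
theorem rlbKernel_le_rlbPaper (a b c : ℕ) : rlbKernel a b c ≤ rlbPaper a b c := by
  unfold rlbKernel rlbPaper
  split_ifs <;> omega

end Table

/-! ## Filter N7 in `paper` mode is kernel grade -/

section STPP

variable {H : Type*} [AddCommGroup H] [Fintype H] [DecidableEq H] {N : ℕ}

/-- **Filter N7, `paper` mode, any distinguished block (kernel):** for an STPP family with non-empty sets in a finite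
abelian `H`, a block `j₀` and directions `d` for the others,
`rlbPaper(|A_{j₀}|,|B_{j₀}|,|C_{j₀}|) + ∑_{i ≠ j₀} gain(dᵢ;|Aᵢ|,|Bᵢ|,|Cᵢ|) ≤ |H|` — exactly the `paper`-mode single-block
bound of census engine v0.10 (`patterns.rank_single_lb`, grade `paper`, with format monotonicity), without any print
fact. [cite: CohnKleinbergSzegedyUmans2005, Thm. 5.5] [cite: BuczynskiPostinghelRupniewski2020, §3.1 (first Lemma)] -/
theorem rlbPaper_add_sum_gain_le_card_of_isSTPP (A B C : Fin N → Finset H) (hS : IsSTPP A B C)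
    (hne : ∀ i, (A i).Nonempty ∧ (B i).Nonempty ∧ (C i).Nonempty) (d : Fin N → Fin 3) (j₀ : Fin N) :
    rlbPaper (A j₀).card (B j₀).card (C j₀).card +
        ∑ i ∈ Finset.univ.erase j₀, gain (d i) (A i).card (B i).card (C i).card ≤ Fintype.card H := by
  have h := tensorRank_add_sum_gain_le_card_of_isSTPP A B C hS hne d j₀
  have ht := rlbPaper_le_tensorRank (A j₀).card (B j₀).card (C j₀).card
  omega

/-- **One fat block, all other blocks thin (the frontier form of N7 in `paper` mode):** if every block other than `j₀`
has a set of size `1`, then `rlbPaper(|A_{j₀}|,|B_{j₀}|,|C_{j₀}|) + ∑ᵢ |Aᵢ||Bᵢ||Cᵢ| ≤ |H| + |A_{j₀}||B_{j₀}||C_{j₀}|`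
(the thin blocks peel at full volume, `gain_thinDir`; stated additively to avoid truncated subtraction).
[cite: CohnKleinbergSzegedyUmans2005, Thm. 5.5] [cite: BuczynskiPostinghelRupniewski2020, §3.1 (first Lemma)] -/
theorem rlbPaper_add_sum_card_mul_le_of_isSTPP_of_thin (A B C : Fin N → Finset H) (hS : IsSTPP A B C)
    (hne : ∀ i, (A i).Nonempty ∧ (B i).Nonempty ∧ (C i).Nonempty) (j₀ : Fin N)
    (hthin : ∀ i, i ≠ j₀ → (A i).card = 1 ∨ (B i).card = 1 ∨ (C i).card = 1) :
    rlbPaper (A j₀).card (B j₀).card (C j₀).card + ∑ i, (A i).card * (B i).card * (C i).card ≤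
      Fintype.card H + (A j₀).card * (B j₀).card * (C j₀).card := by
  have h := rlbPaper_add_sum_gain_le_card_of_isSTPP A B C hS hne
    (fun i => thinDir (A i).card (B i).card (C i).card) j₀
  have e : ∑ i ∈ Finset.univ.erase j₀, gain (thinDir (A i).card (B i).card (C i).card) (A i).card (B i).card (C i).card =
      ∑ i ∈ Finset.univ.erase j₀, (A i).card * (B i).card * (C i).card :=
    Finset.sum_congr rfl fun i hi => gain_thinDir (hthin i (Finset.ne_of_mem_erase hi))
  have e2 := Finset.sum_erase_add (Finset.univ : Finset (Fin N))
    (fun i => (A i).card * (B i).card * (C i).card) (Finset.mem_univ j₀)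
  rw [e] at h
  omega

end STPP

end Summit.MatrixMultiplication.OmegaCensus.STPPRank

end
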